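import Summits.AtomisticToContinuum.Crystallization.Theorems.ChartedZeroExcessLayeredLatticeLiouvilleZZZYRCZU

/-!
# ZZZYRCXRWA — LETTER-SYMMETRY (S₃) TRANSPORT, lower half: the per-sequence contract and the affine realisation of a letter permutation
(binder 26636, line (D); lens-2 g101; critic r1907 (B3) lemma (L3); memo HOME/decomp-a2c-lens-2/g101/memo/S3-TRANSPORT-g101.md)

The symmetric group of the three registries `{0,1,2}` (A, B, C) acts on letter sequences `ℓ ↦ f ∘ ℓ`.  A letter permutation `f` is
realised on the refined coordinates `3γ + ℓ m` by an AFFINE map of every layer: there are `g : ℤ → ℤ` (cell shift per letter),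
a sign `σ₀ ∈ {±1}` and a constant `κ` with `3·g r + f r = σ₀·r + κ` on letters (rotation `r ↦ r+1`: `g = [· = 2]`, `σ₀ = 1`, `κ = 1`;
transposition `r ↦ −r`: `g = −[· ≠ 0]`, `σ₀ = −1`, `κ = 0`).  The induced site map `symSite : (γ, m) ↦ (σ₀γ + (g(ℓ m) − g(ℓ H₀))·(1,1), m)`
(re-centred at the window centre `H₀`) multiplies every refined coordinate DIFFERENCE by `σ₀`, so `n9F`, `d18F`, the coefficients and the
layers are invariant, centre-based pairs stay centre-based, and a raw piece key `(d, Δγ₀, Δγ₁, Δm)` goes to `(d, σ₀Δγ₀ + δ, σ₀Δγ₁ + δ, Δm)`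
with the LETTER-DEPENDENT shift `δ = g(ℓ(d+Δm)) − g(ℓ d)` (`symKey`; inverse `unsymKey`); the guarded tables of the mapped data under the new
sequence are the old tables re-keyed by `unsymKey` (`thetaR0G_sym`, `thetaN0G_sym`).

§1 also fixes the two contract shapes the transport and the readers use: ★ `KernelSlabSoundAtP H₀ R ℓ Far …` — kernel data sound AT ONE letter
sequence on the far layers `Far` (hand-1's half-word PARTS: ZZZYRCXRV `KernelSlabSoundOn` = its `∀ℓ`-closure; `Far := ⊤` is ZZZYRCZU's
`ChordDataValidF ∧ tables`), and ★ `KernelSlabSoundFE H₀ R wd …` — the TYPE contract with EXISTENTIAL data (all the reader needs; implied by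
`KernelSlabSoundF`; the form that symmetry transports, since the transported data depend on out-of-window letters — r1902 (C)(i)).
The transports themselves are ZZZYRCXRW.  Imports ZZZYRCZU only; 0 sorry. [folklore]
-/

namespace Summit.AtomisticToContinuum.Crystallization.Theorems.ChartedZeroExcessLayeredLatticeLiouville

/-! ### §1 the per-sequence contract with a far-layer predicate; the type contract with existential data -/

/-- ★ KERNEL DATA SOUND AT ONE LETTER SEQUENCE `ℓ` ON THE FAR LAYERS `Far` (window coordinates): centre-based data with far layer in `Far`
and paths within `R` layers, guarded piece bounds, no duplicate pairs, completeness for the centre-based in-range pairs with far layer in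
`Far`, and the guarded tables majorised at dyadic exponent `E`.  `Far := ⊤` is `ChordDataValidF ∧ tables` (`kernelSlabSoundAtP_top`). [g101] -/
def KernelSlabSoundAtP (H₀ R : ℕ) (ℓ : ℤ → ℤ) (Far : ℤ → Prop) (lo hi P9max : ℤ) (E : ℕ) (cd : List ChordDatum)
    (TRz TNz : ℤ × ℤ × ℤ × ℤ → ℤ) : Prop :=
  (∀ c ∈ cd, IsCenterBased H₀ c.1 ∧ Far c.1.2.2 ∧ PiecesWithin H₀ R c ∧
      (lo < n9F ℓ c.1 → n9F ℓ c.1 ≤ hi → ∀ i < chordNp c, 0 < n9F ℓ (chordPiece c i) ∧ n9F ℓ (chordPiece c i) ≤ P9max)) ∧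
    (cd.map (·.1)).Nodup ∧
    (∀ x : (Cell 2 × ℤ) × (Cell 2 × ℤ), IsCenterBased H₀ x → Far x.2.2 → lo < n9F ℓ x → n9F ℓ x ≤ hi → ∃ c ∈ cd, c.1 = x) ∧
    ∀ k, thetaR0G ℓ lo hi cd k ≤ (TRz k : ℝ) / 2 ^ E ∧ thetaN0G ℓ lo hi cd k ≤ (TNz k : ℝ) / 2 ^ E

/-- ★ THE TYPE CONTRACT WITH EXISTENTIAL DATA: for every letter sequence agreeing with the window word, SOME valid data with the table
majorants — what the reader consumes (ZZZYRCXRWE), and the form that symmetry transports (the data may depend on out-of-window letters). [g101] -/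
def KernelSlabSoundFE (H₀ R : ℕ) (wd : List ℤ) (lo hi P9max : ℤ) (E : ℕ) (TRz TNz : ℤ × ℤ × ℤ × ℤ → ℤ) : Prop :=
  ∀ ℓ : ℤ → ℤ, IsLetterSeq ℓ → AgreesOnWindow H₀ wd ℓ →
    ∃ cd : List ChordDatum, ChordDataValidF H₀ R ℓ lo hi P9max cd ∧
      ∀ k, thetaR0G ℓ lo hi cd k ≤ (TRz k : ℝ) / 2 ^ E ∧ thetaN0G ℓ lo hi cd k ≤ (TNz k : ℝ) / 2 ^ E

section Basic

variable {H₀ R E : ℕ} {ℓ : ℤ → ℤ} {Far : ℤ → Prop} {lo hi P9max : ℤ} {cd : List ChordDatum} {TRz TNz TR' TN' : ℤ × ℤ × ℤ × ℤ → ℤ}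

/-- the full far-layer predicate: the per-sequence contract IS `ChordDataValidF ∧ tables`. [g101] -/
theorem kernelSlabSoundAtP_top (h : KernelSlabSoundAtP H₀ R ℓ (fun _ => True) lo hi P9max E cd TRz TNz) :
    ChordDataValidF H₀ R ℓ lo hi P9max cd ∧
      ∀ k, thetaR0G ℓ lo hi cd k ≤ (TRz k : ℝ) / 2 ^ E ∧ thetaN0G ℓ lo hi cd k ≤ (TNz k : ℝ) / 2 ^ E :=
  ⟨⟨fun c hc => ⟨(h.1 c hc).1, (h.1 c hc).2.2⟩, h.2.1, fun x hx => h.2.2.1 x hx trivial⟩, h.2.2.2⟩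

/-- conversely. [g101] -/
theorem kernelSlabSoundAtP_of_top (hV : ChordDataValidF H₀ R ℓ lo hi P9max cd)
    (hT : ∀ k, thetaR0G ℓ lo hi cd k ≤ (TRz k : ℝ) / 2 ^ E ∧ thetaN0G ℓ lo hi cd k ≤ (TNz k : ℝ) / 2 ^ E) :
    KernelSlabSoundAtP H₀ R ℓ (fun _ => True) lo hi P9max E cd TRz TNz :=
  ⟨fun c hc => ⟨(hV.1 c hc).1, trivial, (hV.1 c hc).2⟩, hV.2.1, fun x hx _ => hV.2.2 x hx, hT⟩

/-- monotone in the tables. [g101] -/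
theorem kernelSlabSoundAtP_mono (hR : ∀ k, TRz k ≤ TR' k) (hN : ∀ k, TNz k ≤ TN' k)
    (h : KernelSlabSoundAtP H₀ R ℓ Far lo hi P9max E cd TRz TNz) : KernelSlabSoundAtP H₀ R ℓ Far lo hi P9max E cd TR' TN' := by
  refine ⟨h.1, h.2.1, h.2.2.1, fun k => ⟨((h.2.2.2 k).1).trans ?_, ((h.2.2.2 k).2).trans ?_⟩⟩
  · exact div_le_div_of_nonneg_right (by exact_mod_cast hR k) (by positivity)
  · exact div_le_div_of_nonneg_right (by exact_mod_cast hN k) (by positivity)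

/-- monotone (contravariantly) in the far-layer predicate when the data happen to lie in the smaller one. [g101] -/
theorem kernelSlabSoundAtP_far {Far' : ℤ → Prop} (hF : ∀ m, Far' m → Far m) (hd : ∀ c ∈ cd, Far' c.1.2.2)
    (h : KernelSlabSoundAtP H₀ R ℓ Far lo hi P9max E cd TRz TNz) : KernelSlabSoundAtP H₀ R ℓ Far' lo hi P9max E cd TRz TNz :=
  ⟨fun c hc => ⟨(h.1 c hc).1, hd c hc, (h.1 c hc).2.2⟩, h.2.1, fun x hx hf => h.2.2.1 x hx (hF _ hf), h.2.2.2⟩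

/-- an exact type certificate (ZZZYRCZU `KernelSlabSoundF`, fixed data) gives the existential-data contract. [g101] -/
theorem kernelSlabSoundFE_of_F {wd : List ℤ} (h : KernelSlabSoundF H₀ R wd lo hi P9max E cd TRz TNz) :
    KernelSlabSoundFE H₀ R wd lo hi P9max E TRz TNz := fun ℓ hℓ hag => ⟨cd, h ℓ hℓ hag⟩

/-- the existential-data contract is monotone in the tables. [g101] -/
theorem kernelSlabSoundFE_mono {wd : List ℤ} (hR : ∀ k, TRz k ≤ TR' k) (hN : ∀ k, TNz k ≤ TN' k)
    (h : KernelSlabSoundFE H₀ R wd lo hi P9max E TRz TNz) : KernelSlabSoundFE H₀ R wd lo hi P9max E TR' TN' := by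
  intro ℓ hℓ hag
  obtain ⟨cd, hV, hT⟩ := h ℓ hℓ hag
  exact ⟨cd, kernelSlabSoundAtP_top (kernelSlabSoundAtP_mono hR hN (kernelSlabSoundAtP_of_top hV hT))⟩

end Basic

/-! ### §2 the affine realisation of a letter permutation -/

section Sym

variable (g : ℤ → ℤ) (σ₀ : ℤ) (ℓ : ℤ → ℤ) (H₀ : ℕ)

/-- the site map: `(γ, m) ↦ (σ₀γ + (g(ℓ m) − g(ℓ H₀))·(1,1), m)`. [g101] -/
def symSite (s : Cell 2 × ℤ) : Cell 2 × ℤ := (fun i => σ₀ * s.1 i + (g (ℓ s.2) - g (ℓ H₀)), s.2)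

/-- its inverse (for `σ₀² = 1`). [g101] -/
def unsymSite (s : Cell 2 × ℤ) : Cell 2 × ℤ := (fun i => σ₀ * (s.1 i - (g (ℓ s.2) - g (ℓ H₀))), s.2)

/-- the pair map. [g101] -/
def symPair (x : (Cell 2 × ℤ) × (Cell 2 × ℤ)) : (Cell 2 × ℤ) × (Cell 2 × ℤ) := (symSite g σ₀ ℓ H₀ x.1, symSite g σ₀ ℓ H₀ x.2)

/-- the inverse pair map. [g101] -/
def unsymPair (x : (Cell 2 × ℤ) × (Cell 2 × ℤ)) : (Cell 2 × ℤ) × (Cell 2 × ℤ) :=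
  (unsymSite g σ₀ ℓ H₀ x.1, unsymSite g σ₀ ℓ H₀ x.2)

/-- the datum map: endpoints and interior nodes. [g101] -/
def symChord (c : ChordDatum) : ChordDatum := (symPair g σ₀ ℓ H₀ c.1, c.2.map (symSite g σ₀ ℓ H₀))

/-- the key map `(d, Δγ₀, Δγ₁, Δm) ↦ (d, σ₀Δγ₀ + δ, σ₀Δγ₁ + δ, Δm)`, `δ = g(ℓ(d+Δm)) − g(ℓ d)`. [g101] -/
def symKey (k : ℤ × ℤ × ℤ × ℤ) : ℤ × ℤ × ℤ × ℤ :=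
  (k.1, σ₀ * k.2.1 + (g (ℓ (k.1 + k.2.2.2)) - g (ℓ k.1)), σ₀ * k.2.2.1 + (g (ℓ (k.1 + k.2.2.2)) - g (ℓ k.1)), k.2.2.2)

/-- the inverse key map `(d, Δγ₀, Δγ₁, Δm) ↦ (d, σ₀(Δγ₀ − δ), σ₀(Δγ₁ − δ), Δm)`. [g101] -/
def unsymKey (k : ℤ × ℤ × ℤ × ℤ) : ℤ × ℤ × ℤ × ℤ :=
  (k.1, σ₀ * (k.2.1 - (g (ℓ (k.1 + k.2.2.2)) - g (ℓ k.1))), σ₀ * (k.2.2.1 - (g (ℓ (k.1 + k.2.2.2)) - g (ℓ k.1))), k.2.2.2)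

variable {g σ₀ ℓ H₀} {ℓ' : ℤ → ℤ} {κ : ℤ}

/-- `unsymSite ∘ symSite = id`. [g101] -/
theorem unsymSite_symSite (hσ2 : σ₀ * σ₀ = 1) (s : Cell 2 × ℤ) : unsymSite g σ₀ ℓ H₀ (symSite g σ₀ ℓ H₀ s) = s := by
  obtain ⟨γ, m⟩ := s
  refine Prod.ext (funext fun i => ?_) rfl
  show σ₀ * (σ₀ * γ i + (g (ℓ m) - g (ℓ H₀)) - (g (ℓ m) - g (ℓ H₀))) = γ i
  linear_combination γ i * hσ2

/-- `symSite ∘ unsymSite = id`. [g101] -/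
theorem symSite_unsymSite (hσ2 : σ₀ * σ₀ = 1) (s : Cell 2 × ℤ) : symSite g σ₀ ℓ H₀ (unsymSite g σ₀ ℓ H₀ s) = s := by
  obtain ⟨γ, m⟩ := s
  refine Prod.ext (funext fun i => ?_) rfl
  show σ₀ * (σ₀ * (γ i - (g (ℓ m) - g (ℓ H₀)))) + (g (ℓ m) - g (ℓ H₀)) = γ i
  linear_combination (γ i - (g (ℓ m) - g (ℓ H₀))) * hσ2

/-- `unsymPair ∘ symPair = id`. [g101] -/
theorem unsymPair_symPair (hσ2 : σ₀ * σ₀ = 1) (x : (Cell 2 × ℤ) × (Cell 2 × ℤ)) :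
    unsymPair g σ₀ ℓ H₀ (symPair g σ₀ ℓ H₀ x) = x :=
  Prod.ext (unsymSite_symSite hσ2 x.1) (unsymSite_symSite hσ2 x.2)

/-- `symPair ∘ unsymPair = id`. [g101] -/
theorem symPair_unsymPair (hσ2 : σ₀ * σ₀ = 1) (x : (Cell 2 × ℤ) × (Cell 2 × ℤ)) :
    symPair g σ₀ ℓ H₀ (unsymPair g σ₀ ℓ H₀ x) = x :=
  Prod.ext (symSite_unsymSite hσ2 x.1) (symSite_unsymSite hσ2 x.2)

/-- `symPair` is injective. [g101] -/
theorem symPair_injective (hσ2 : σ₀ * σ₀ = 1) : Function.Injective (symPair g σ₀ ℓ H₀) := fun x y h => by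
  rw [← unsymPair_symPair hσ2 x, h, unsymPair_symPair hσ2]

/-- `symKey ∘ unsymKey = id`. [g101] -/
theorem symKey_unsymKey (hσ2 : σ₀ * σ₀ = 1) (k : ℤ × ℤ × ℤ × ℤ) : symKey g σ₀ ℓ (unsymKey g σ₀ ℓ k) = k := by
  obtain ⟨d, a, b, dm⟩ := k
  simp only [symKey, unsymKey, Prod.mk.injEq]
  exact ⟨trivial, by linear_combination (a - (g (ℓ (d + dm)) - g (ℓ d))) * hσ2,
    by linear_combination (b - (g (ℓ (d + dm)) - g (ℓ d))) * hσ2, trivial⟩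

/-- `unsymKey ∘ symKey = id`. [g101] -/
theorem unsymKey_symKey (hσ2 : σ₀ * σ₀ = 1) (k : ℤ × ℤ × ℤ × ℤ) : unsymKey g σ₀ ℓ (symKey g σ₀ ℓ k) = k := by
  obtain ⟨d, a, b, dm⟩ := k
  simp only [symKey, unsymKey, Prod.mk.injEq]
  exact ⟨trivial, by linear_combination a * hσ2, by linear_combination b * hσ2, trivial⟩

/-- `symKey a = k ↔ a = unsymKey k`. [g101] -/
theorem symKey_eq_iff (hσ2 : σ₀ * σ₀ = 1) (a k : ℤ × ℤ × ℤ × ℤ) : symKey g σ₀ ℓ a = k ↔ a = unsymKey g σ₀ ℓ k := by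
  constructor
  · rintro rfl; rw [unsymKey_symKey hσ2]
  · rintro rfl; rw [symKey_unsymKey hσ2]

/-- layers are unchanged. [g101] -/
theorem symSite_snd (s : Cell 2 × ℤ) : (symSite g σ₀ ℓ H₀ s).2 = s.2 := rfl

/-- the far pair of the mapped datum. [g101] -/
theorem symChord_fst (c : ChordDatum) : (symChord g σ₀ ℓ H₀ c).1 = symPair g σ₀ ℓ H₀ c.1 := rfl

/-- ★ the refined coordinate of a mapped site: `σ₀·(old) + const` (coherence `3·g(ℓ m) + ℓ' m = σ₀·ℓ m + κ` along the sequence). [g101] -/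
theorem refF0_sym (hcoh : ∀ m, 3 * g (ℓ m) + ℓ' m = σ₀ * ℓ m + κ) (s : Cell 2 × ℤ) :
    refF0 ℓ' (symSite g σ₀ ℓ H₀ s) = σ₀ * refF0 ℓ s + (κ - 3 * g (ℓ H₀)) := by
  simp only [refF0, symSite]
  linear_combination hcoh s.2

/-- likewise for the second coordinate. [g101] -/
theorem refF1_sym (hcoh : ∀ m, 3 * g (ℓ m) + ℓ' m = σ₀ * ℓ m + κ) (s : Cell 2 × ℤ) :
    refF1 ℓ' (symSite g σ₀ ℓ H₀ s) = σ₀ * refF1 ℓ s + (κ - 3 * g (ℓ H₀)) := by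
  simp only [refF1, symSite]
  linear_combination hcoh s.2

/-- ★ `n9` is invariant. [g101] -/
theorem n9F_sym (hσ2 : σ₀ * σ₀ = 1) (hcoh : ∀ m, 3 * g (ℓ m) + ℓ' m = σ₀ * ℓ m + κ) (x : (Cell 2 × ℤ) × (Cell 2 × ℤ)) :
    n9F ℓ' (symPair g σ₀ ℓ H₀ x) = n9F ℓ x := by
  simp only [n9F, symPair, refF0_sym hcoh, refF1_sym hcoh, symSite_snd]
  linear_combination ((refF0 ℓ x.2 - refF0 ℓ x.1) * (refF0 ℓ x.2 - refF0 ℓ x.1) +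
    (refF0 ℓ x.2 - refF0 ℓ x.1) * (refF1 ℓ x.2 - refF1 ℓ x.1) + (refF1 ℓ x.2 - refF1 ℓ x.1) * (refF1 ℓ x.2 - refF1 ℓ x.1)) * hσ2

/-- ★ `d18` is invariant. [g101] -/
theorem d18F_sym (hσ2 : σ₀ * σ₀ = 1) (hcoh : ∀ m, 3 * g (ℓ m) + ℓ' m = σ₀ * ℓ m + κ) (x q : (Cell 2 × ℤ) × (Cell 2 × ℤ)) :
    d18F ℓ' (symPair g σ₀ ℓ H₀ x) (symPair g σ₀ ℓ H₀ q) = d18F ℓ x q := by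
  simp only [d18F, symPair, refF0_sym hcoh, refF1_sym hcoh, symSite_snd]
  linear_combination (2 * (refF0 ℓ x.2 - refF0 ℓ x.1) * (refF0 ℓ q.2 - refF0 ℓ q.1) +
    2 * (refF1 ℓ x.2 - refF1 ℓ x.1) * (refF1 ℓ q.2 - refF1 ℓ q.1) + (refF0 ℓ x.2 - refF0 ℓ x.1) * (refF1 ℓ q.2 - refF1 ℓ q.1) +
    (refF0 ℓ q.2 - refF0 ℓ q.1) * (refF1 ℓ x.2 - refF1 ℓ x.1)) * hσ2

/-- piece count is invariant. [g101] -/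
theorem chordNp_sym (c : ChordDatum) : chordNp (symChord g σ₀ ℓ H₀ c) = chordNp c := by
  simp only [chordNp, symChord, List.length_map]

/-- the node list of the mapped datum is the mapped node list. [g101] -/
theorem chordNodes_sym (c : ChordDatum) : chordNodes (symChord g σ₀ ℓ H₀ c) = (chordNodes c).map (symSite g σ₀ ℓ H₀) := by
  simp only [chordNodes, symChord, symPair, List.map_cons, List.map_append, List.map_nil]

/-- the pieces of the mapped datum are the mapped pieces. [g101] -/
theorem chordPiece_sym (c : ChordDatum) (i : ℕ) : chordPiece (symChord g σ₀ ℓ H₀ c) i = symPair g σ₀ ℓ H₀ (chordPiece c i) := by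
  have h2 : (symChord g σ₀ ℓ H₀ c).1.2 = symSite g σ₀ ℓ H₀ c.1.2 := rfl
  simp only [chordPiece, chordNodes_sym, h2, List.getD_map]
  rfl

/-- the raw key of a mapped piece is the mapped key. [g101] -/
theorem pieceKeyF_sym (q : (Cell 2 × ℤ) × (Cell 2 × ℤ)) : pieceKeyF (symPair g σ₀ ℓ H₀ q) = symKey g σ₀ ℓ (pieceKeyF q) := by
  obtain ⟨⟨γ, d⟩, ⟨γ', m⟩⟩ := q
  have hm : d + (m - d) = m := by ring
  simp only [pieceKeyF, symPair, symSite, symKey, hm, Prod.mk.injEq]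
  exact ⟨trivial, by ring, by ring, trivial⟩

/-- the ideal R coefficient is invariant. [g101] -/
theorem coefR0F_sym (hσ2 : σ₀ * σ₀ = 1) (hcoh : ∀ m, 3 * g (ℓ m) + ℓ' m = σ₀ * ℓ m + κ) (c : ChordDatum) :
    coefR0F ℓ' (symChord g σ₀ ℓ H₀ c) = coefR0F ℓ c := by
  simp only [coefR0F, chordNp_sym, symChord_fst, n9F_sym hσ2 hcoh]

/-- the ideal N coefficient is invariant. [g101] -/
theorem coefN0F_sym (hσ2 : σ₀ * σ₀ = 1) (hcoh : ∀ m, 3 * g (ℓ m) + ℓ' m = σ₀ * ℓ m + κ) (c : ChordDatum) (i : ℕ) :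
    coefN0F ℓ' (symChord g σ₀ ℓ H₀ c) i = coefN0F ℓ c i := by
  simp only [coefN0F, chordNp_sym, chordPiece_sym, symChord_fst, n9F_sym hσ2 hcoh, d18F_sym hσ2 hcoh]

/-- ★ the guarded R table of the mapped data under `ℓ'` at key `k` is the table of the data under `ℓ` at `unsymKey k`. [g101] -/
theorem thetaR0G_sym (hσ2 : σ₀ * σ₀ = 1) (hcoh : ∀ m, 3 * g (ℓ m) + ℓ' m = σ₀ * ℓ m + κ) (lo hi : ℤ) (cd : List ChordDatum)
    (k : ℤ × ℤ × ℤ × ℤ) :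
    thetaR0G ℓ' lo hi (cd.map (symChord g σ₀ ℓ H₀)) k = thetaR0G ℓ lo hi cd (unsymKey g σ₀ ℓ k) := by
  unfold thetaR0G
  rw [List.map_map]
  congr 1
  refine List.map_congr_left fun c _ => ?_
  simp only [Function.comp_apply, symChord_fst, n9F_sym hσ2 hcoh, chordNp_sym, chordPiece_sym, pieceKeyF_sym, symKey_eq_iff hσ2,
    coefR0F_sym hσ2 hcoh]

/-- ★ the guarded N table likewise. [g101] -/
theorem thetaN0G_sym (hσ2 : σ₀ * σ₀ = 1) (hcoh : ∀ m, 3 * g (ℓ m) + ℓ' m = σ₀ * ℓ m + κ) (lo hi : ℤ) (cd : List ChordDatum)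
    (k : ℤ × ℤ × ℤ × ℤ) :
    thetaN0G ℓ' lo hi (cd.map (symChord g σ₀ ℓ H₀)) k = thetaN0G ℓ lo hi cd (unsymKey g σ₀ ℓ k) := by
  unfold thetaN0G
  rw [List.map_map]
  congr 1
  refine List.map_congr_left fun c _ => ?_
  simp only [Function.comp_apply, symChord_fst, n9F_sym hσ2 hcoh, chordNp_sym, chordPiece_sym, pieceKeyF_sym, symKey_eq_iff hσ2,
    coefN0F_sym hσ2 hcoh]

/-- centre-based pairs stay centre-based (the re-centring term). [g101] -/
theorem isCenterBased_sym {x : (Cell 2 × ℤ) × (Cell 2 × ℤ)} (h : IsCenterBased H₀ x) : IsCenterBased H₀ (symPair g σ₀ ℓ H₀ x) := by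
  refine ⟨funext fun i => ?_, h.2⟩
  show σ₀ * x.1.1 i + (g (ℓ x.1.2) - g (ℓ H₀)) = 0
  rw [h.1, h.2]; simp

/-- and conversely under the inverse map. [g101] -/
theorem isCenterBased_unsym {x : (Cell 2 × ℤ) × (Cell 2 × ℤ)} (h : IsCenterBased H₀ x) :
    IsCenterBased H₀ (unsymPair g σ₀ ℓ H₀ x) := by
  refine ⟨funext fun i => ?_, h.2⟩
  show σ₀ * (x.1.1 i - (g (ℓ x.1.2) - g (ℓ H₀))) = 0
  rw [h.1, h.2]; simp

/-- `PiecesWithin` the centre radius is invariant (layers unchanged). [g101] -/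
theorem piecesWithin_sym {R : ℕ} {c : ChordDatum} (h : PiecesWithin (H₀ : ℤ) R c) : PiecesWithin (H₀ : ℤ) R (symChord g σ₀ ℓ H₀ c) := by
  intro i hi
  rw [chordNp_sym] at hi
  rw [chordPiece_sym]
  exact h i hi

/-- the far pairs of the mapped data are the mapped far pairs. [g101] -/
theorem map_fst_symChord (cd : List ChordDatum) :
    (cd.map (symChord g σ₀ ℓ H₀)).map (·.1) = (cd.map (·.1)).map (symPair g σ₀ ℓ H₀) := by
  simp only [List.map_map]
  rfl

end Sym

end Summit.AtomisticToContinuum.Crystallization.Theorems.ChartedZeroExcessLayeredLatticeLiouville
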